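import Summits.QuantumFields.YangMills.Theorems.ColdStartUniversalityUniformColdStartMixingOfLogSobolev
import Summits.QuantumFields.YangMills.Theorems.ColdStartUniversalityColdEntropyStubs
import HarnessLib

/-!
# Route `ColdStartUniversality`, crux K_A1 `UniformColdStartMixing` (stmt-QuantumFields-24809, aside), LINE 4 «cold_entropy»:
# the registered stub `stub_entropyDissipation` and the crux BY NAME from a K-uniform log-Sobolev inequality (ULS)

Two-line sequel (seat `ym-line-csu-p1`, g21; `--supports stmt-QuantumFields-24809`) of the route-independent
`…UniformColdStartMixingOfLogSobolev` (`entropyDissipation_of_uniformLogSobolev`, statement = the skeleton's `EntropyDissipation` with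
abbreviations unfolded): here it is read BY NAME (definitional unfolding of `Lines_cold_entropy.lean`'s abbreviations) and composed with
the skeleton kernel `uniformColdStartMixing_of_budget_of_dissipation`.
* ★★ `stub_entropyDissipation_of_uniformLogSobolev : (ULS) → __Registered.stub_entropyDissipation`;
* ★★ `UniformColdStartMixing_of_uniformLogSobolev_of_budget : (ULS) → stub_coldEntropyBudget → UniformColdStartMixing`.
HONEST FRAMING: (ULS) and `stub_coldEntropyBudget` are K-UNIFORM and OPEN; item 24809 is ASIDE and is not restated; nothing K-uniform
is proved; no crux, rung or summit statement is proved; the Yang–Mills mass gap is NOT proved.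
-/

set_option autoImplicit false

noncomputable section

namespace Summit.QuantumFields.YangMills.Theorems.ColdStartUniversality

open MeasureTheory ProbabilityTheory
open scoped BigOperators NNReal ENNReal
open Literature.Probability.Process Literature.MathematicalPhysics.QuantumFieldTheory
open Literature.MathematicalPhysics.QuantumLattice (fundamentalRep fundamentalLatticeRep continuous_fundamentalRep)
open Literature.MathematicalPhysics.QuantumFieldTheory.Balaban1983to89

/-- ★★ **`stub_entropyDissipation` ⇐ (ULS)**, BY NAME: the registered XL stub of LINE 4 «cold_entropy» follows from a K-uniform
generator-form log-Sobolev inequality for Bałaban's Wilson measures in physical units (`entropyDissipation_of_uniformLogSobolev`,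
read through the skeleton's abbreviations by definitional unfolding). [cite: BakryGentilLedoux2014, Thm 5.2.1] -/
theorem stub_entropyDissipation_of_uniformLogSobolev
    (hULS : ∃ γ₁ : ℝ, 0 < γ₁ ∧ ∀ (F : T3ContinuumYM3Torus.T3Family) (γ : ℝ), 0 < γ → γ ≤ γ₁ →
      ∃ c : ℝ, 0 < c ∧ ∃ K₀ : ℕ, ∀ K : ℕ, K₀ ≤ K →
        ∀ (f : (Edge 3 ((F.P K).sitesPerDir 0) × Fin 2 × Fin 2 × Bool → ℝ) → ℝ), ContDiff ℝ 3 f →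
        let coords : GaugeConfig 3 ((F.P K).sitesPerDir 0) (Matrix.specialUnitaryGroup (Fin 2) ℂ) →
            (Edge 3 ((F.P K).sitesPerDir 0) × Fin 2 × Fin 2 × Bool → ℝ) :=
          fun V q => (fun z : ℂ => if q.2.2.2 then z.im else z.re)
            ((fundamentalRep (Fin 2) (V q.1) : Matrix (Fin 2) (Fin 2) ℂ) q.2.1 q.2.2.1)
        let gen : GaugeConfig 3 ((F.P K).sitesPerDir 0) (Matrix.specialUnitaryGroup (Fin 2) ℂ) → ℝ := fun V =>
          (∑ i : Edge 3 ((F.P K).sitesPerDir 0) × Fin 2 × Fin 2 × Bool, fderiv ℝ f (coords V) (Pi.single i 1) *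
              (fun z : ℂ => if i.2.2.2 then z.im else z.re)
                ((latticeLangevinDynamics (fundamentalLatticeRep 2) ((γ * (F.P K).eps)⁻¹ / 2)).drift
                  (matrixConfig (fundamentalRep (Fin 2)) V) i.1 i.2.1 i.2.2.1) +
          1 / 2 * ∑ i : Edge 3 ((F.P K).sitesPerDir 0) × Fin 2 × Fin 2 × Bool,
            ∑ j : Edge 3 ((F.P K).sitesPerDir 0) × Fin 2 × Fin 2 × Bool,
            fderiv ℝ (fun z => fderiv ℝ f z (Pi.single i 1)) (coords V) (Pi.single j 1) *
              ∑ n : Edge 3 ((F.P K).sitesPerDir 0) × NoiseIdx 2,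
                (if n.1 = i.1 then (fun z : ℂ => if i.2.2.2 then z.im else z.re)
                  ((latticeLangevinDynamics (fundamentalLatticeRep 2) ((γ * (F.P K).eps)⁻¹ / 2)).noise
                    (matrixConfig (fundamentalRep (Fin 2)) V) i.1 n.2 i.2.1 i.2.2.1) else 0) *
                (if n.1 = j.1 then (fun z : ℂ => if j.2.2.2 then z.im else z.re)
                  ((latticeLangevinDynamics (fundamentalLatticeRep 2) ((γ * (F.P K).eps)⁻¹ / 2)).noise
                    (matrixConfig (fundamentalRep (Fin 2)) V) j.1 n.2 j.2.1 j.2.2.1) else 0))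
        c * (F.P K).eps *
            ((∫ V, f (coords V) ^ 2 * Real.log (f (coords V) ^ 2)
                ∂(wilsonMeasure (d := 3) (L := (F.P K).sitesPerDir 0) (fundamentalRep (Fin 2)) ((γ * (F.P K).eps)⁻¹ / 2))) -
              (∫ V, f (coords V) ^ 2
                ∂(wilsonMeasure (d := 3) (L := (F.P K).sitesPerDir 0) (fundamentalRep (Fin 2)) ((γ * (F.P K).eps)⁻¹ / 2))) *
                Real.log (∫ V, f (coords V) ^ 2
                  ∂(wilsonMeasure (d := 3) (L := (F.P K).sitesPerDir 0) (fundamentalRep (Fin 2)) ((γ * (F.P K).eps)⁻¹ / 2)))) ≤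
          -∫ V, f (coords V) * gen V
            ∂(wilsonMeasure (d := 3) (L := (F.P K).sitesPerDir 0) (fundamentalRep (Fin 2)) ((γ * (F.P K).eps)⁻¹ / 2))) :
    Summit.QuantumFields.YangMills.Cruxes.UniformColdStartMixing.ColdEntropy.__Registered.stub_entropyDissipation :=
  entropyDissipation_of_uniformLogSobolev hULS

/-- ★★ **THE CRUX `UniformColdStartMixing` (hence `NeutralColdStartMixing` a fortiori) from (ULS) + the K-uniform entropy budget
`stub_coldEntropyBudget`** — the skeleton's composition `uniformColdStartMixing_of_budget_of_dissipation`.  Both hypotheses are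
K-UNIFORM and OPEN. [cite: BakryGentilLedoux2014, Thm 5.2.1] -/
theorem UniformColdStartMixing_of_uniformLogSobolev_of_budget
    (hULS : ∃ γ₁ : ℝ, 0 < γ₁ ∧ ∀ (F : T3ContinuumYM3Torus.T3Family) (γ : ℝ), 0 < γ → γ ≤ γ₁ →
      ∃ c : ℝ, 0 < c ∧ ∃ K₀ : ℕ, ∀ K : ℕ, K₀ ≤ K →
        ∀ (f : (Edge 3 ((F.P K).sitesPerDir 0) × Fin 2 × Fin 2 × Bool → ℝ) → ℝ), ContDiff ℝ 3 f →
        let coords : GaugeConfig 3 ((F.P K).sitesPerDir 0) (Matrix.specialUnitaryGroup (Fin 2) ℂ) →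
            (Edge 3 ((F.P K).sitesPerDir 0) × Fin 2 × Fin 2 × Bool → ℝ) :=
          fun V q => (fun z : ℂ => if q.2.2.2 then z.im else z.re)
            ((fundamentalRep (Fin 2) (V q.1) : Matrix (Fin 2) (Fin 2) ℂ) q.2.1 q.2.2.1)
        let gen : GaugeConfig 3 ((F.P K).sitesPerDir 0) (Matrix.specialUnitaryGroup (Fin 2) ℂ) → ℝ := fun V =>
          (∑ i : Edge 3 ((F.P K).sitesPerDir 0) × Fin 2 × Fin 2 × Bool, fderiv ℝ f (coords V) (Pi.single i 1) *
              (fun z : ℂ => if i.2.2.2 then z.im else z.re)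
                ((latticeLangevinDynamics (fundamentalLatticeRep 2) ((γ * (F.P K).eps)⁻¹ / 2)).drift
                  (matrixConfig (fundamentalRep (Fin 2)) V) i.1 i.2.1 i.2.2.1) +
          1 / 2 * ∑ i : Edge 3 ((F.P K).sitesPerDir 0) × Fin 2 × Fin 2 × Bool,
            ∑ j : Edge 3 ((F.P K).sitesPerDir 0) × Fin 2 × Fin 2 × Bool,
            fderiv ℝ (fun z => fderiv ℝ f z (Pi.single i 1)) (coords V) (Pi.single j 1) *
              ∑ n : Edge 3 ((F.P K).sitesPerDir 0) × NoiseIdx 2,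
                (if n.1 = i.1 then (fun z : ℂ => if i.2.2.2 then z.im else z.re)
                  ((latticeLangevinDynamics (fundamentalLatticeRep 2) ((γ * (F.P K).eps)⁻¹ / 2)).noise
                    (matrixConfig (fundamentalRep (Fin 2)) V) i.1 n.2 i.2.1 i.2.2.1) else 0) *
                (if n.1 = j.1 then (fun z : ℂ => if j.2.2.2 then z.im else z.re)
                  ((latticeLangevinDynamics (fundamentalLatticeRep 2) ((γ * (F.P K).eps)⁻¹ / 2)).noise
                    (matrixConfig (fundamentalRep (Fin 2)) V) j.1 n.2 j.2.1 j.2.2.1) else 0))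
        c * (F.P K).eps *
            ((∫ V, f (coords V) ^ 2 * Real.log (f (coords V) ^ 2)
                ∂(wilsonMeasure (d := 3) (L := (F.P K).sitesPerDir 0) (fundamentalRep (Fin 2)) ((γ * (F.P K).eps)⁻¹ / 2))) -
              (∫ V, f (coords V) ^ 2
                ∂(wilsonMeasure (d := 3) (L := (F.P K).sitesPerDir 0) (fundamentalRep (Fin 2)) ((γ * (F.P K).eps)⁻¹ / 2))) *
                Real.log (∫ V, f (coords V) ^ 2
                  ∂(wilsonMeasure (d := 3) (L := (F.P K).sitesPerDir 0) (fundamentalRep (Fin 2)) ((γ * (F.P K).eps)⁻¹ / 2)))) ≤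
          -∫ V, f (coords V) * gen V
            ∂(wilsonMeasure (d := 3) (L := (F.P K).sitesPerDir 0) (fundamentalRep (Fin 2)) ((γ * (F.P K).eps)⁻¹ / 2)))
    (hBudget : Summit.QuantumFields.YangMills.Cruxes.UniformColdStartMixing.ColdEntropy.__Registered.stub_coldEntropyBudget) :
    Summit.QuantumFields.YangMills.Theses.ColdStartUniversality.UniformColdStartMixing :=
  Summit.QuantumFields.YangMills.Cruxes.UniformColdStartMixing.ColdEntropy.uniformColdStartMixing_of_budget_of_dissipation hBudget
    (stub_entropyDissipation_of_uniformLogSobolev hULS)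

end Summit.QuantumFields.YangMills.Theorems.ColdStartUniversality

end
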